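import Literature.Barriers.AtomisticToContinuum.NoUniversallyOptimalLattice3D
import Literature.Algebra.EuclideanLattices.FccBccLattices
import Literature.Algebra.EuclideanLattices.GaussianLatticeSums
import HarnessLib

/-!
# Proof of the barrier `NoUniversallyOptimalLattice3D` (no universally optimal lattice in `ℝ³`)

Topic: `Literature/Barriers/AtomisticToContinuum` — discharge of the named fact
`Literature.Barriers.AtomisticToContinuum.NoUniversallyOptimalLattice3D` (Cohn–Kumar 2007, §9:
universal optimality "provably fails for lattices in dimensions 3, 5, 6, and 7"; Cohn–Kumar–
Miller–Radchenko–Viazovska 2022, §1: in `d = 3` "at density 1, [fcc and bcc] have the same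
energy by Poisson summation, because they are dual to each other"). The sibling file
`NoUniversallyOptimalLattice3DProofs.lean` discharges the other named fact of the barrier file,
the certified numerical comparison `CohnKumar2007_fcc_gaussianEnergy_gt_bcc`; the present proof
does not use it.

## The proof formalised here

Suppose `L ⊂ ℝ³` is a lattice of covolume `1` whose Gaussian energies
`E_c(L) = ∑_{x ∈ L∖0} e^{-c‖x‖²}` are minimal among covolume-`1` lattices for every `c > 0`.

1. *Steep Gaussians see only the minimal norm* (`le_norm_sq_of_gaussianEnergy_le`): if
   `E_c(L) ≤ E_c(M)` for all `c > 0` and every nonzero vector of `M` has `‖y‖² ≥ m`, then so does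
   every nonzero vector of `L` (otherwise `e^{-c‖x‖²} ≤ E_c(L) ≤ E_c(M) ≤ e^{-(c-1)m} E_1(M)` fails
   for large `c`). With `M = fcc` at unit density
   (`Literature.Algebra.EuclideanLattices.exists_fccLattice`): `‖x‖² ≥ 2^{1/3}` on `L ∖ 0`.
2. *Duality* (`gaussianEnergy_dualLattice_le`): by the Poisson summation formula for Gaussians
   on lattices (`Literature.Algebra.EuclideanLattices.tsum_gaussianFunction_eq`,
   `∑_{y ∈ Λ} ρ_s(y) = covol(Λ)⁻¹ s³ ∑_{w ∈ Λ*} ρ_{1/s}(w)`), `E_c(L*) ≤ E_c(M*)` for every unit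
   `M` and every `c > 0`. With `M = bcc` at unit density, whose dual is fcc
   (`Literature.Algebra.EuclideanLattices.exists_bccLattice`): `‖y‖² ≥ 2^{1/3}` on `L* ∖ 0`.
3. *Gauss's theorem with rigidity*
   (`Literature.Algebra.EuclideanLattices.exists_mem_dualLattice_norm_sq_eq_of_extremal`,
   Cassels Ch. II §3.4 Theorem III): `‖x‖² ≥ 2^{1/3} = (2 covol²)^{1/3}` on `L ∖ 0` forces `L` to
   be extremal, and then `L*` contains a nonzero `z` with `‖z‖² = ¾ · 2^{2/3} < 2^{1/3}`
   (`27 < 32`), contradicting step 2. (For `L = fcc` this `z` is a minimal vector of bcc.)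

This is the mechanism printed by Cohn–Kumar (a universally optimal lattice must maximise the
minimal norm at fixed density, hence be `A₃` by Gauss, which loses to its dual `A₃*`), with the
final numerical comparison `E_1(A₃) > E_1(A₃*)` replaced by the exact Poisson-duality argument.

The two explicit competitors (the fcc and bcc lattices at unit density, with the `D₃` form
bound `two_le_dThreeForm` and the coordinate lemmas `inner_fin_three`, `norm_sq_fin_three`) are
those of `Literature/Algebra/EuclideanLattices/FccBccLattices.lean`, used through
`open Literature.Algebra.EuclideanLattices`; this file does not restate them.

## References

* H. Cohn, A. Kumar, *Universally optimal distribution of points on spheres*, JAMS 20 (2007),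
  §9 (p. 139 / arXiv p. 25).
* H. Cohn, A. Kumar, S. D. Miller, D. Radchenko, M. Viazovska, *Universal optimality of the `E₈`
  and Leech lattices and interpolation formulas*, Ann. Math. 196 (2022), §1.
* J. W. S. Cassels, *An Introduction to the Geometry of Numbers*, Ch. II §3.4, Theorem III.
* J. H. Conway, N. J. A. Sloane, *SPLAG*, Ch. 4 §6.3 (`D₃ =` fcc), §7.1 (`D₃* =` bcc).
-/

noncomputable section

open MeasureTheory Module Submodule Literature.Algebra.EuclideanLattices
open scoped InnerProductSpace Real

namespace Literature.Barriers.AtomisticToContinuum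

/-! ## Gaussian energies of lattices -/

section Energy

variable (Λ : Submodule ℤ (EuclideanSpace ℝ (Fin 3))) [DiscreteTopology Λ]

/-- The Gaussian `x ↦ e^{-c‖x‖²}`, `c > 0`, is summable over a discrete subgroup of `ℝ³`
(`summable_gaussianFunction_sub` with `s = √(π/c)`). [folklore] -/
theorem summable_exp_neg_mul_norm_sq {c : ℝ} (hc : 0 < c) :
    Summable fun y : Λ => Real.exp (-c * ‖(y : EuclideanSpace ℝ (Fin 3))‖ ^ 2) := by
  have hπc : 0 < π / c := div_pos Real.pi_pos hc
  have hs : Real.sqrt (π / c) ≠ 0 := (Real.sqrt_pos.mpr hπc).ne'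
  have hπ : (π : ℝ) ≠ 0 := Real.pi_ne_zero
  refine (summable_gaussianFunction_sub Λ hs 0).congr fun y => ?_
  rw [sub_zero, gaussianFunction, Real.sq_sqrt hπc.le]
  congr 1
  field_simp

/-- The Gaussian energy is summable on `Λ ∖ {0}`. [folklore] -/
theorem summable_exp_neg_mul_norm_sq_subtype {c : ℝ} (hc : 0 < c) :
    Summable fun x : {x : EuclideanSpace ℝ (Fin 3) // x ∈ (Λ : Set (EuclideanSpace ℝ (Fin 3))) ∧
      x ≠ 0} => Real.exp (-c * ‖x.1‖ ^ 2) := by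
  let i : {x : EuclideanSpace ℝ (Fin 3) // x ∈ (Λ : Set (EuclideanSpace ℝ (Fin 3))) ∧ x ≠ 0} → Λ :=
    fun x => ⟨x.1, x.2.1⟩
  have hi : Function.Injective i := fun x y hxy =>
    Subtype.ext (congrArg (fun z : Λ => (z : EuclideanSpace ℝ (Fin 3))) hxy)
  refine ((summable_exp_neg_mul_norm_sq Λ hc).comp_injective hi).congr fun x => ?_
  simp [i]

/-- **The theta sum of a lattice is `1 +` its Gaussian energy**:
`∑_{y ∈ Λ} e^{-c‖y‖²} = 1 + E_c(Λ)` (the term `y = 0`; Cohn–Kumar's `E_f` omits the origin).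
[cite: CohnKumar2006, §9 (energy of a periodic configuration)] -/
theorem tsum_exp_neg_mul_norm_sq {c : ℝ} (hc : 0 < c) :
    ∑' y : Λ, Real.exp (-c * ‖(y : EuclideanSpace ℝ (Fin 3))‖ ^ 2) =
      1 + gaussianEnergy c (Λ : Set (EuclideanSpace ℝ (Fin 3))) := by
  classical
  set g : EuclideanSpace ℝ (Fin 3) → ℝ := fun x => Real.exp (-c * ‖x‖ ^ 2) with hg
  set T : Set (EuclideanSpace ℝ (Fin 3)) :=
    {x | x ∈ (Λ : Set (EuclideanSpace ℝ (Fin 3))) ∧ x ≠ 0} with hT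
  have hs := summable_exp_neg_mul_norm_sq Λ hc
  rw [hs.tsum_eq_add_tsum_ite 0]
  have h0 : Real.exp (-c * ‖((0 : Λ) : EuclideanSpace ℝ (Fin 3))‖ ^ 2) = 1 := by simp
  rw [h0]
  congr 1
  have hΛT : (Λ : Set (EuclideanSpace ℝ (Fin 3))) ∩ T = T := Set.inter_eq_right.mpr fun x hx => hx.1
  calc ∑' n : Λ, (if n = 0 then 0 else Real.exp (-c * ‖(n : EuclideanSpace ℝ (Fin 3))‖ ^ 2))
      = ∑' n : Λ, T.indicator g n := by
        refine tsum_congr fun n => ?_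
        by_cases hn : n = 0
        · simp [hn, hT]
        · have hn' : (n : EuclideanSpace ℝ (Fin 3)) ∈ T := ⟨n.2, by simpa using hn⟩
          simp [hn, hn', hg]
    _ = ∑' x : EuclideanSpace ℝ (Fin 3), (Λ : Set (EuclideanSpace ℝ (Fin 3))).indicator
          (T.indicator g) x := tsum_subtype (Λ : Set (EuclideanSpace ℝ (Fin 3))) (T.indicator g)
    _ = ∑' x : EuclideanSpace ℝ (Fin 3), T.indicator g x := by rw [Set.indicator_indicator, hΛT]
    _ = ∑' x : T, g x := (tsum_subtype T g).symm
    _ = gaussianEnergy c (Λ : Set (EuclideanSpace ℝ (Fin 3))) := rfl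

end Energy

/-! ## Step 1: steep Gaussians and the minimal norm -/

/-- **Steep Gaussians see only the minimal norm** (Cohn–Kumar 2007, §9: a universally optimal
configuration minimises `e^{-c|x|²}`-energy for every `c`, hence — letting `c → ∞` — maximises
the minimal distance). If `E_c(Λ) ≤ E_c(M)` for all `c > 0` and every nonzero vector of `M`
has `‖y‖² ≥ m`, then every nonzero vector of `Λ` has `‖x‖² ≥ m`: otherwise
`e^{-c‖x‖²} ≤ E_c(Λ) ≤ E_c(M) ≤ e^{-(c-1)m} E_1(M)`, i.e. `e^{c(m - ‖x‖²) - m} ≤ E_1(M)` for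
all `c ≥ 1`, which fails for large `c`. [cite: CohnKumar2006, §9 (arXiv p. 25)] -/
theorem le_norm_sq_of_gaussianEnergy_le {Λ M : Submodule ℤ (EuclideanSpace ℝ (Fin 3))}
    [DiscreteTopology Λ] [DiscreteTopology M]
    (hle : ∀ c : ℝ, 0 < c → gaussianEnergy c (Λ : Set (EuclideanSpace ℝ (Fin 3))) ≤
      gaussianEnergy c (M : Set (EuclideanSpace ℝ (Fin 3))))
    {m : ℝ} (hM : ∀ y ∈ M, y ≠ 0 → m ≤ ‖y‖ ^ 2) :
    ∀ x ∈ Λ, x ≠ 0 → m ≤ ‖x‖ ^ 2 := by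
  intro x hx hx0
  by_contra hlt
  push Not at hlt
  set δ := m - ‖x‖ ^ 2 with hδ
  have hδ0 : 0 < δ := by linarith
  set K := gaussianEnergy 1 (M : Set (EuclideanSpace ℝ (Fin 3))) with hK
  have hK0 : 0 ≤ K := tsum_nonneg fun _ => (Real.exp_pos _).le
  -- the chain of inequalities for `c ≥ 1`
  have step : ∀ c : ℝ, 1 ≤ c → Real.exp (-c * ‖x‖ ^ 2) ≤ Real.exp (-(c - 1) * m) * K := by
    intro c hc1
    have hc : 0 < c := by linarith
    have hsΛ := summable_exp_neg_mul_norm_sq_subtype Λ hc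
    have hsM := summable_exp_neg_mul_norm_sq_subtype M hc
    have hsM1 := summable_exp_neg_mul_norm_sq_subtype M one_pos
    calc Real.exp (-c * ‖x‖ ^ 2)
        ≤ gaussianEnergy c (Λ : Set (EuclideanSpace ℝ (Fin 3))) :=
          hsΛ.le_tsum ⟨x, hx, hx0⟩ fun _ _ => (Real.exp_pos _).le
      _ ≤ gaussianEnergy c (M : Set (EuclideanSpace ℝ (Fin 3))) := hle c hc
      _ ≤ ∑' y : {y : EuclideanSpace ℝ (Fin 3) // y ∈ (M : Set (EuclideanSpace ℝ (Fin 3))) ∧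
            y ≠ 0}, Real.exp (-(c - 1) * m) * Real.exp (-1 * ‖y.1‖ ^ 2) := by
          refine hsM.tsum_le_tsum (fun y => ?_) (hsM1.mul_left _)
          rw [← Real.exp_add]
          refine Real.exp_le_exp.mpr ?_
          have hy := hM y.1 y.2.1 y.2.2
          nlinarith
      _ = Real.exp (-(c - 1) * m) * K := tsum_mul_left
  -- choose `c` large
  set c : ℝ := max 1 ((K + m) / δ + 1) with hcdef
  have hc1 : 1 ≤ c := le_max_left _ _
  have hcge : (K + m) / δ + 1 ≤ c := le_max_right _ _
  have hcδ : K + m + δ ≤ c * δ := by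
    have := mul_le_mul_of_nonneg_right hcge hδ0.le
    rwa [add_mul, one_mul, div_mul_cancel₀ _ hδ0.ne'] at this
  have h := step c hc1
  -- `exp (c δ - m) ≤ K`
  have h' : Real.exp (c * δ - m) ≤ K := by
    have hpos : 0 < Real.exp (-(c - 1) * m) := Real.exp_pos _
    have : Real.exp (-c * ‖x‖ ^ 2) / Real.exp (-(c - 1) * m) ≤ K := by
      rw [div_le_iff₀ hpos]; exact h.trans_eq (mul_comm _ _)
    rw [← Real.exp_sub] at this
    convert this using 2
    rw [hδ]; ring
  have := Real.add_one_le_exp (c * δ - m)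
  linarith

/-! ## Step 2: Poisson duality -/

/-- **Energies of dual lattices** (Cohn–Kumar–Miller–Radchenko–Viazovska 2022, §1, via the
Poisson summation formula `∑_{y ∈ Λ} ρ_s(y) = covol(Λ)⁻¹ s³ ∑_{w ∈ Λ*} ρ_{1/s}(w)`): if `Λ` and `M`
both have covolume `1` and `E_c(Λ) ≤ E_c(M)` for every `c > 0`, then `E_c(Λ*) ≤ E_c(M*)` for
every `c > 0`. [cite: CohnEtAl2019, §1 (paragraph before Theorem 1.4)] -/
theorem gaussianEnergy_dualLattice_le {Λ M : Submodule ℤ (EuclideanSpace ℝ (Fin 3))}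
    [DiscreteTopology Λ] [IsZLattice ℝ Λ] [DiscreteTopology M] [IsZLattice ℝ M]
    (hΛ : ZLattice.covolume Λ = 1) (hM : ZLattice.covolume M = 1)
    (hle : ∀ c : ℝ, 0 < c → gaussianEnergy c (Λ : Set (EuclideanSpace ℝ (Fin 3))) ≤
      gaussianEnergy c (M : Set (EuclideanSpace ℝ (Fin 3))))
    {c : ℝ} (hc : 0 < c) :
    gaussianEnergy c (dualLattice Λ : Set (EuclideanSpace ℝ (Fin 3))) ≤
      gaussianEnergy c (dualLattice M : Set (EuclideanSpace ℝ (Fin 3))) := by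
  have hcπ : 0 < c / π := div_pos hc Real.pi_pos
  set s : ℝ := Real.sqrt (c / π) with hsdef
  have hs : 0 < s := Real.sqrt_pos.mpr hcπ
  have hs2 : s ^ 2 = c / π := Real.sq_sqrt hcπ.le
  set c' : ℝ := π ^ 2 / c with hc'def
  have hc' : 0 < c' := div_pos (by positivity) hc
  have hπ : (π : ℝ) ≠ 0 := Real.pi_ne_zero
  have hρ : ∀ w : EuclideanSpace ℝ (Fin 3), gaussianFunction s⁻¹ w = Real.exp (-c * ‖w‖ ^ 2) := by
    intro w
    rw [gaussianFunction, inv_pow, hs2]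
    congr 1
    field_simp
  have hρ' : ∀ y : EuclideanSpace ℝ (Fin 3), gaussianFunction s y = Real.exp (-c' * ‖y‖ ^ 2) := by
    intro y
    rw [gaussianFunction, hs2, hc'def]
    congr 1
    field_simp
  have hPΛ := tsum_gaussianFunction_eq Λ hs
  have hPM := tsum_gaussianFunction_eq M hs
  simp_rw [hρ, hρ'] at hPΛ hPM
  rw [hΛ, inv_one, one_mul] at hPΛ
  rw [hM, inv_one, one_mul] at hPM
  have key : ∑' y : Λ, Real.exp (-c' * ‖(y : EuclideanSpace ℝ (Fin 3))‖ ^ 2) ≤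
      ∑' y : M, Real.exp (-c' * ‖(y : EuclideanSpace ℝ (Fin 3))‖ ^ 2) := by
    rw [tsum_exp_neg_mul_norm_sq Λ hc', tsum_exp_neg_mul_norm_sq M hc']
    linarith [hle c' hc']
  rw [hPΛ, hPM] at key
  have key' := le_of_mul_le_mul_left key (pow_pos hs _)
  rw [tsum_exp_neg_mul_norm_sq (dualLattice Λ) hc, tsum_exp_neg_mul_norm_sq (dualLattice M) hc]
    at key'
  linarith

/-! ## The barrier -/

/-- **Discharge of the barrier `NoUniversallyOptimalLattice3D`** (Cohn–Kumar 2007, §9: universal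
optimality "provably fails for lattices in dimension 3"): no lattice `L ⊂ ℝ³` of covolume `1`
minimises every Gaussian energy `E_c`, `c > 0`, among lattices of covolume `1`. Proof: steps
1–3 of the module docstring — `L` and (by Poisson duality) `L*` would both have minimal norm
`≥ 2^{1/3}` at covolume `1`; by Gauss's theorem with rigidity, `L` is then extremal and `L*` has a
vector of squared norm `¾·2^{2/3} < 2^{1/3}`. [cite: CohnKumar2006, §9 (arXiv p. 25)] -/
theorem NoUniversallyOptimalLattice3D_holds : NoUniversallyOptimalLattice3D := by
  intro h
  obtain ⟨L, hLd, hLz, hcov, hopt⟩ := h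
  set μ : ℝ := (2 : ℝ) ^ ((1 : ℝ) / 3) with hμ
  have hμ0 : 0 < μ := by positivity
  have hμ3 : μ ^ 3 = 2 := two_rpow_third_pow_three
  have hμlt : μ < 4 / 3 := by
    refine lt_of_pow_lt_pow_left₀ 3 (by norm_num) ?_
    rw [hμ3]; norm_num
  obtain ⟨F, iF, iF', hFcov, hFmin⟩ := exists_fccLattice
  obtain ⟨B, iB, iB', hBcov, hBmin⟩ := exists_bccLattice
  -- Step 1: every nonzero vector of `L` has squared norm `≥ 2^{1/3}`
  have hLmin : ∀ x ∈ L, x ≠ 0 → μ ≤ ‖x‖ ^ 2 :=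
    le_norm_sq_of_gaussianEnergy_le (fun c hc => hopt F iF iF' hFcov c hc) hFmin
  -- Step 2: the same for the dual lattice, by Poisson duality against bcc
  have hdual : ∀ c : ℝ, 0 < c →
      gaussianEnergy c (dualLattice L : Set (EuclideanSpace ℝ (Fin 3))) ≤
        gaussianEnergy c (dualLattice B : Set (EuclideanSpace ℝ (Fin 3))) := fun c hc =>
    gaussianEnergy_dualLattice_le hcov hBcov (fun c hc => hopt B iB iB' hBcov c hc) hc
  have hLdmin : ∀ y ∈ dualLattice L, y ≠ 0 → μ ≤ ‖y‖ ^ 2 :=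
    le_norm_sq_of_gaussianEnergy_le hdual hBmin
  -- Step 3: Gauss's theorem with rigidity
  obtain ⟨z, hz, hz0, hzn⟩ := exists_mem_dualLattice_norm_sq_eq_of_extremal L hμ0 hLmin
    (by rw [hcov, hμ3]; norm_num)
  have hzμ := hLdmin z hz hz0
  rw [hcov, one_pow, mul_one] at hzn
  nlinarith

end Literature.Barriers.AtomisticToContinuum
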